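/-
Copyright (c) 2026 the pub-hodgecm-mathlib formalisation cell (harness21).  Prover seat hodgecm-mathlib-A-p19 (g25): T3′ P-1 row (ii) «ROW-2 PER LITERAL» of the
depth-zero κ-transfer (road «S3-tree», crux H413) — the close of the unit-index seam O1∕O2∕O3∕O4∕O8a∕Σ2.
-/
import Literature.NumberTheory.Rogawski1990.DepthZeroKappaTransferTypeOneRowTwoFrame  -- helper 2 (this seat): the frame at `w`, `ord π_w` odd (⇒ ★ p846292 helper 1: the parity dichotomy)
import Literature.NumberTheory.Automorphic.DeepElementCyclicLatticeStable            -- ★ p845915 O8b rider (A-p12): `ncard_fixedBy_unitary_rank_eq_ncard_free'`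
import HarnessLib

/-!
# The depth-zero κ-transfer, type (1): ROW 2 at the θ̄ = 0 literal `t_1`

Topic `NumberTheory/Rogawski1990`; namespace `Literature.NumberTheory.Rogawski1990`.  THEOREMS ONLY (no definition, no instance, no notation, no named
fact, no `sorry`); kernel lane `--supports stmt-HodgeConjecture-24833` (road «S3-tree», T3′ «DEPTH-ZERO κ-TRANSFER» P-1 assembly, row (ii)).

**`ncard_rankStratum_two_eq_of_congr_one`** — for `t ∈ G′_v` congruent (by an isometry `Tl : H′_v ≅ Φ₃`) to Flicker's θ̄ = 0 literal `t_1(x₁,x₂,x₃)`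
(frame `h`, Gram `(−2,1,2)`):
`((#{q ∈ Fix_t(G′_v ⧸ K_v) : rank(red((q.out⁻¹ t q.out)_w) − 1) = 2} : ℕ) : ℚ) = if (Q₁+P) % 2 = 0 ∧ (Q₁+Q₂) % 2 = 0 then (N(v)+1)²·N(v)^{Q₁+Q₂+P−2} else 0`
(the θ̄ = 1 literals are `DepthZeroKappaTransferTypeOneRowTwo`).
The stratum is A-p12's «free» stratum (★ O8b FILE 3 §3 ∘ ★ rider), i.e. ★ O8a-4's set of self-dual `t_w`-cyclic lattices for the frame `Q_w = (Tl⁻¹ D_π h)_w`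
(Gram `diag(−2, 1, 2)` — helper 2); ★ helper 1 prices it as `[C : R^×]` on the parity literal (criterion orders `Q₁ + P`, `Q₁ + Q₂`, `P + Q₂`
all even) and `0` off it; ★ Σ2-CM `relIndex_units_adjoin_comap_norm_eq_place` gives
`[C : R^×] = (q+1)² q^{S−2}`, `S = Q₁ + P + Q₂`.

HONEST LABEL: HC_CM is proved only modulo the 2 remaining named inputs (hLiu418 24832, h413 24833) until rung 0 closes; this file is count-neutral.

## References
* [Rogawski1990] J. D. Rogawski, *Automorphic Representations of Unitary Groups in Three Variables* (1990), §4.9 Prop. 4.9.1 (b) p. 55, Lemma 4.9.3 p. 56.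
* [Flicker1998UnitaryFL] Y. Z. Flicker, *Elementary proof of the fundamental lemma for a unitary group*, Canad. J. Math. 50 (1998), Prop. 11 p. 87, §6 p. 95.
* [Kottwitz1986] R. E. Kottwitz, *Base change for unit elements of Hecke algebras*, Compositio Math. 60 (1986), §3.
* [Jacobowitz1962] R. Jacobowitz, *Hermitian forms over local fields*, Amer. J. Math. 84 (1962), §7 Thm. 7.1.
-/

set_option autoImplicit false

noncomputable section

open NumberField IsDedekindDomain Matrix Polynomial Finset
open Literature.NumberTheory.Automorphic Literature.NumberTheory.Automorphic.UnitaryGroup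
open Literature.NumberTheory.Automorphic.IntegralReduction Literature.NumberTheory.GaloisRepresentations
open scoped Matrix MatrixGroups ValuativeRel

namespace Literature.NumberTheory.Rogawski1990

section ThetaZero

variable (L : Type) [Field L] [NumberField L] [IsCMField L] (H' : Matrix (Fin 3) (Fin 3) L)
  {v : HeightOneSpectrum (𝓞 ↥(maximalRealSubfield L))}

set_option synthInstance.maxHeartbeats 200000 in
set_option maxHeartbeats 800000 in  -- one long assembly (frame, three parities, the composed index)
open scoped Classical in
/-- **ROW 2 AT THE θ̄ = 0 LITERAL (measure-free)**: for `t ∈ G′_v = U(H′)(L⁺_v)` congruent by the ISOMETRY `Tl` to Flicker's `t_1(x₁,x₂,x₃)` (`x_i`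
of norm one, ≡ 1 (mod 𝔪_w), `P = ord_w(x₁−x₃)`, `Q₁ = ord_w(x₁−x₂)`, `Q₂ = ord_w(x₃−x₂)`) at an inert place `v` away from `2` with `H′` hyperspecial
at `w`, the regular-nilpotent stratum of the fixed cosets counts
`n₂(t) = #{q ∈ Fix_t(G′_v ⧸ K_v) : rank(red((q⁻¹ t q)_w) − 1) = 2} = (q+1)² q^{Q₁+Q₂+P−2}` if `Q₁+P` and `Q₁+Q₂` are both even (the parity literal of the
eigen-line Gram vector `(0,0,0)`), and `0` otherwise (`q = N(v)`).  Chain: ★ FILE 3 §3 transport ∘ ★ rider `ncard_fixedBy_unitary_rank_eq_ncard_free′`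
∘ [frame `Tl⁻¹ h` at `w`, Gram `(−2, 1, 2)`] ∘ ★ `SplitTorusOrderStratumParity` (O8a-4 ∘ O8a-1 ∘ O8a-∃) ∘ ★ Σ2-CM
`relIndex_units_adjoin_comap_norm_eq_place` (O8a-5Σ ∘ Σ2-F ∘ O3 ∘ O2 ∘ O1).  Binders = ★ `sum_ncard_rankStrata_eq_phiZero_of_congr` minus its unused
`hH'u hy h₁₂ h₂₃ h₁₃ hlev htri`, plus `hH'w hH'i hTl` of ★ `exists_four_matched_flicker_representatives`.
[cite: Rogawski1990, §4.9 Lemma 4.9.3 p. 56, Prop. 4.9.1 (b) p. 55] [cite: Flicker1998UnitaryFL, Prop. 11 p. 87; §6 p. 95] [cite: Kottwitz1986, §3] -/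
theorem ncard_rankStratum_two_eq_of_congr_one
    (hH' : (H'.map (IsCMField.complexConj L))ᵀ = H') (w : PlacesOver L v)
    (hw : IsCMField.complexConj L • w.1 = w.1) (hv : Algebra.IsUnramifiedIn (𝓞 L) v.asIdeal)
    (hH'w : IsUnit (placeForm H' w.1)) (hH'i : hH'w.unit ∈ glInt 3 (w.1.adicCompletion L))
    (h2 : IsUnit (2 : 𝒪[w.1.adicCompletion L]))
    {e x₁ x₂ x₃ : LocalRing L v} (h2e : 2 * e = 1)
    (hx₁ : conjLocal L (IsCMField.complexConj L) v x₁ * x₁ = 1) (hx₂ : conjLocal L (IsCMField.complexConj L) v x₂ * x₂ = 1)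
    (hx₃ : conjLocal L (IsCMField.complexConj L) v x₃ * x₃ = 1)
    (Tl : GL (Fin 3) (LocalRing L v))
    (hTl : formCongr (conjLocal L (IsCMField.complexConj L) v) Tl (Matrix.of fun i j : Fin 3 => if i.val + j.val + 1 = 3 then (1 : LocalRing L v) else 0) =
      (adelicForm L 3 H').map (adeleToLocal L v))
    (ψ : ↥(UnitaryGroup.«local» L (IsCMField.complexConj L) 3 H' v) ≃ₜ*
        ↥(UnitaryGroup.«local» L (IsCMField.complexConj L) 3 (Matrix.of fun i j : Fin 3 => if i.val + j.val + 1 = 3 then (1 : L) else 0) v))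
    (t : (cmDatum L 3 H').Local v)
    (hψ : ∀ g, (ψ g).val = Tl * g.val * Tl⁻¹)
    (hlit : (ψ t).val.val =
          !![e * (x₁ + x₃), 0, -(e * (x₁ - x₃)); 0, x₂, 0; -(e * (x₁ - x₃)), 0, e * (x₁ + x₃)])
    {P Q₁ Q₂ : ℕ} (hP : Valued.v (x₁ w - x₃ w) = WithZero.exp (-(P : ℤ))) (hQ₁ : Valued.v (x₁ w - x₂ w) = WithZero.exp (-(Q₁ : ℤ)))
    (hQ₂ : Valued.v (x₃ w - x₂ w) = WithZero.exp (-(Q₂ : ℤ)))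
    (hd₁ : Valued.v (x₁ w - 1) < 1) (hd₂ : Valued.v (x₂ w - 1) < 1) (hd₃ : Valued.v (x₃ w - 1) < 1) :
    (({q : (cmDatum L 3 H').Local v ⧸ cmLocalIntegralLevel L 3 H' v |
        q ∈ MulAction.fixedBy ((cmDatum L 3 H').Local v ⧸ cmLocalIntegralLevel L 3 H' v) t ∧
          (redMat ((((q.out⁻¹ * t * q.out : (cmDatum L 3 H').Local v)).val : GL (Fin 3) (LocalRing L v)).val.map
            (Pi.evalRingHom (fun w' : PlacesOver L v => w'.1.adicCompletion L) w)) - 1).rank = 2}.ncard : ℕ) : ℚ) =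
      if (Q₁ + P) % 2 = 0 ∧ (Q₁ + Q₂) % 2 = 0 then
        (((Ideal.absNorm v.asIdeal + 1) ^ 2 * Ideal.absNorm v.asIdeal ^ (Q₁ + Q₂ + P - 2) : ℕ) : ℚ) else 0 := by
  classical
  haveI : Algebra.IsQuadraticExtension ↥(maximalRealSubfield L) L := IsCMField.isQuadraticExtension L
  have hc1 : IsCMField.complexConj L ≠ 1 := IsCMField.complexConj_ne_one L
  -- Step 1: the stratum as a lattice count on the one-place model (★ FILE 3 §3 transport ∘ ★ rider)
  have ht := deep_of_congr_flickerTorusEltOne L H' w h2e Tl ψ t hψ hlit hd₁ hd₂ hd₃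
  rw [ncard_fixedBy_rankStratum_eq_ncard_localNonsplitEquiv L 3 H' v w hw t 2]
  have hrid := ncard_fixedBy_unitary_rank_eq_ncard_free' (galAdicCompletionMap (L := L) (IsCMField.complexConj L) hw) hH'w.unit
    (localNonsplitEquiv (IsCMField.complexConj L) H' hc1 w hw t) ht
  simp only [show (3 : ℕ) - 1 = 2 from rfl] at hrid
  refine (congrArg (fun m : ℕ => (m : ℚ)) hrid).trans ?_
  -- tokens at `w`
  set σw := galAdicCompletionMap (L := L) (IsCMField.complexConj L) hw with hσw_def
  set evw : LocalRing L v →+* w.1.adicCompletion L := Pi.evalRingHom (fun w' : PlacesOver L v => w'.1.adicCompletion L) w with hevw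
  -- the inert dictionary at `w` (★ Σ2-CM, ★ `UnitaryGroupIntegralPointsReductionInert`)
  have hσσ := galAdicCompletionMap_galAdicCompletionMap_of_smul_eq (IsCMField.complexConj L) w hc1 hw
  have hσO := mem_integer_galAdicCompletionMap (IsCMField.complexConj L) v w hw
  have hmove := exists_isUnit_galAdicCompletionMap_sub (IsCMField.complexConj L) v hc1 hv w hw
  have hσv := valuation_galAdicCompletionMap_eq (IsCMField.complexConj L) v w hw
  obtain ⟨δ, hδ, hσδ⟩ := exists_skew_unit_galAdicCompletionMap (IsCMField.complexConj L) v hc1 hv w hw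
  -- the `σ_w`-fixed uniformizer `ϖ = ι_w(ϖ_v)`
  have hϖv := valued_toPlace_uniformizer L v w hv
  set ϖ := toPlace v w (HeckeCharacter.uniformizer ↥(maximalRealSubfield L) v : v.adicCompletion ↥(maximalRealSubfield L)) with hϖdef
  have hϖ0 : ϖ ≠ 0 := by intro h; rw [h, map_zero] at hϖv; exact WithZero.zero_ne_coe hϖv
  have hσϖ : σw ϖ = ϖ := galAdicCompletionMap_toPlace_self L v w hw _
  -- Step 2: the frame at `w`
  obtain ⟨P₁, hP₁, hQ⟩ := exists_frameOne_of_congr L H' h2e Tl ψ t hψ hlit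
  set Qw : GL (Fin 3) (w.1.adicCompletion L) := Matrix.GeneralLinearGroup.map evw (Tl⁻¹ * P₁) with hQwdef
  have hQwval : (Qw : Matrix (Fin 3) (Fin 3) (w.1.adicCompletion L)) = ((Tl⁻¹ * P₁).val : Matrix (Fin 3) (Fin 3) (LocalRing L v)).map evw := rfl
  set γ : Fin 3 → w.1.adicCompletion L := ![x₁ w, x₂ w, x₃ w] with hγdef
  have hγev : (fun m => evw (![x₁, x₂, x₃] m)) = γ := by
    funext m; fin_cases m <;> rfl
  have hTQw : ((t.val : GL (Fin 3) (LocalRing L v)).val.map evw) * (Qw : Matrix (Fin 3) (Fin 3) (w.1.adicCompletion L)) =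
      (Qw : Matrix (Fin 3) (Fin 3) (w.1.adicCompletion L)) * diagonal γ := by
    have h := congrArg (fun M : Matrix (Fin 3) (Fin 3) (LocalRing L v) => M.map evw) hQ
    simp only [Matrix.map_mul, Matrix.diagonal_map (map_zero evw), hγev] at h
    rw [hQwval]
    exact h
  have hTmat : (((localNonsplitEquiv (IsCMField.complexConj L) H' hc1 w hw t :
      ↥(unitaryGroupOfForm σw (placeForm H' w.1))) : GL (Fin 3) (w.1.adicCompletion L)) : Matrix (Fin 3) (Fin 3) (w.1.adicCompletion L)) =
        (Qw : Matrix (Fin 3) (Fin 3) (w.1.adicCompletion L)) * diagonal γ * ((Qw⁻¹ : GL (Fin 3) (w.1.adicCompletion L)) : Matrix (Fin 3) (Fin 3) (w.1.adicCompletion L)) := by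
    have hcoe : (((localNonsplitEquiv (IsCMField.complexConj L) H' hc1 w hw t :
        ↥(unitaryGroupOfForm σw (placeForm H' w.1))) : GL (Fin 3) (w.1.adicCompletion L)) : Matrix (Fin 3) (Fin 3) (w.1.adicCompletion L)) =
          (t.val : GL (Fin 3) (LocalRing L v)).val.map evw := rfl
    rw [hcoe, ← hTQw, Matrix.mul_assoc, ← Units.val_mul, mul_inv_cancel, Units.val_one, Matrix.mul_one]
  simp only [hTmat]
  -- the Gram matrix of the frame at `w`
  have hGw : formCongr σw Qw ((hH'w.unit : GL (Fin 3) (w.1.adicCompletion L)) : Matrix (Fin 3) (Fin 3) (w.1.adicCompletion L)) =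
      diagonal ![-2, 1, 2] := by
    have hG := formCongr_frameOne_eq L (conjLocal L (IsCMField.complexConj L) v) _ Tl P₁ hTl hP₁
    have h : (formCongr (conjLocal L (IsCMField.complexConj L) v) (Tl⁻¹ * P₁) ((adelicForm L 3 H').map (adeleToLocal L v))).map evw =
        (!![-2, 0, 0; 0, 1, 0; 0, 0, 2] : Matrix (Fin 3) (Fin 3) (LocalRing L v)).map evw :=
      congrArg (fun A : Matrix (Fin 3) (Fin 3) (LocalRing L v) => A.map evw) hG
    rw [hevw, formCongr_map_evalRingHom L w hw, localForm_map_eval L 3 H' v w] at h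
    rw [IsUnit.unit_spec, hσw_def, hQwdef, hevw, h]
    ext i j
    fin_cases i <;> fin_cases j <;> simp [Matrix.diagonal]
  -- the inputs of the one-place dichotomy (★ `SplitTorusOrderStratumParity`)
  have hJh : ((((hH'w.unit : GL (Fin 3) (w.1.adicCompletion L)) : Matrix (Fin 3) (Fin 3) (w.1.adicCompletion L))).map σw)ᵀ =
      (hH'w.unit : GL (Fin 3) (w.1.adicCompletion L)) :=
    placeForm_hermitian_of_smul_eq (IsCMField.complexConj L) w H' hH' hw
  have hd0 : (![-2, 1, 2] : Fin 3 → w.1.adicCompletion L) 0 = -2 := rfl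
  have hd1 : (![-2, 1, 2] : Fin 3 → w.1.adicCompletion L) 1 = 1 := rfl
  have hd2 : (![-2, 1, 2] : Fin 3 → w.1.adicCompletion L) 2 = 2 := rfl
  have hσd : ∀ i, σw (![-2, 1, 2] i) = ![-2, 1, 2] i := by
    intro i; fin_cases i
    · show σw (-2) = -2
      rw [map_neg, map_ofNat]
    · show σw 1 = 1
      exact map_one _
    · show σw 2 = 2
      exact map_ofNat σw 2
  have hn1 : ∀ i, σw (γ i) * γ i = 1 := by
    intro i; fin_cases i
    · exact galAdicCompletionMap_apply_mul_self_of_conjLocal L v w hw hx₁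
    · exact galAdicCompletionMap_apply_mul_self_of_conjLocal L v w hw hx₂
    · exact galAdicCompletionMap_apply_mul_self_of_conjLocal L v w hw hx₃
  have hγv : ∀ i, ValuativeRel.valuation (w.1.adicCompletion L) (γ i) = 1 := fun i => valuation_eq_one_of_map_mul_self_eq_one L w hw (hn1 i)
  have hγO : ∀ i, γ i ∈ 𝒪[w.1.adicCompletion L] := fun i => (Valuation.mem_integer_iff _ _).2 (hγv i).le
  have hγ0 : ∀ i, γ i ≠ 0 := fun i h0 => by have := hγv i; rw [h0, map_zero] at this; exact zero_ne_one this
  have hσγ : ∀ i, σw (γ i) = (γ i)⁻¹ := fun i => eq_inv_of_mul_eq_one_left (hn1 i)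
  have hγ1 : ∀ i, ValuativeRel.valuation (w.1.adicCompletion L) (γ i - 1) < 1 := by
    intro i; fin_cases i
    · exact (v_lt_one_iff_valuation_lt_one _).1 hd₁
    · exact (v_lt_one_iff_valuation_lt_one _).1 hd₂
    · exact (v_lt_one_iff_valuation_lt_one _).1 hd₃
  have hne : ∀ {x y : w.1.adicCompletion L} {Q : ℕ}, Valued.v (x - y) = WithZero.exp (-(Q : ℤ)) → x ≠ y := by
    intro x y Q h hxy
    rw [hxy, sub_self, map_zero] at h
    exact WithZero.zero_ne_coe h
  have hinj : Function.Injective γ := by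
    intro i j hij
    have h12 : γ 0 ≠ γ 1 := hne hQ₁
    have h13 : γ 0 ≠ γ 2 := hne hP
    have h32 : γ 2 ≠ γ 1 := hne hQ₂
    fin_cases i <;> fin_cases j
    all_goals first | rfl | (exfalso; revert hij; simp [h12, h13, h32, h12.symm, h13.symm, h32.symm])
  -- the parity data: the criterion scalars have `|·| = exp(E_i)`
  have hv2 : Valued.v (2 : w.1.adicCompletion L) = 1 := (isUnit_two_integer_iff_valued_eq_one (L := L) w.1).1 h2
  -- valuations of the three criterion scalars
  have hprod0 : (univ.erase (0 : Fin 3)) = {1, 2} := by decide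
  have hprod1 : (univ.erase (1 : Fin 3)) = {0, 2} := by decide
  have hprod2 : (univ.erase (2 : Fin 3)) = {0, 1} := by decide
  have hv10 : Valued.v (γ 1 - γ 0) = WithZero.exp (-(Q₁ : ℤ)) := by rw [Valuation.map_sub_swap]; exact hQ₁
  have hv12 : Valued.v (γ 1 - γ 2) = WithZero.exp (-(Q₂ : ℤ)) := by rw [Valuation.map_sub_swap]; exact hQ₂
  have hv20 : Valued.v (γ 2 - γ 0) = WithZero.exp (-(P : ℤ)) := by rw [Valuation.map_sub_swap]; exact hP
  have hγ01 : Valued.v (γ 0 - γ 1) = WithZero.exp (-(Q₁ : ℤ)) := hQ₁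
  have hγ02 : Valued.v (γ 0 - γ 2) = WithZero.exp (-(P : ℤ)) := hP
  have hγ21 : Valued.v (γ 2 - γ 1) = WithZero.exp (-(Q₂ : ℤ)) := hQ₂
  have hE0 : Valued.v (![-2, 1, 2] 0 * ∏ j ∈ univ.erase (0 : Fin 3), (γ 0 - γ j)) = WithZero.exp (-((Q₁ : ℤ) + P)) := by
    rw [hprod0, Finset.prod_pair (by decide), hd0]
    simp only [map_mul, Valuation.map_neg, hv2, one_mul, hγ01, hγ02, ← WithZero.exp_add]
    congr 1; ring
  have hE1 : Valued.v (![-2, 1, 2] 1 * ∏ j ∈ univ.erase (1 : Fin 3), (γ 1 - γ j)) = WithZero.exp (-((Q₁ : ℤ) + Q₂)) := by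
    rw [hprod1, Finset.prod_pair (by decide), hd1]
    simp only [map_mul, one_mul, hv10, hv12, ← WithZero.exp_add]
    congr 1; ring
  have hE2 : Valued.v (![-2, 1, 2] 2 * ∏ j ∈ univ.erase (2 : Fin 3), (γ 2 - γ j)) = WithZero.exp (-((P : ℤ) + Q₂)) := by
    rw [hprod2, Finset.prod_pair (by decide), hd2]
    simp only [map_mul, hv2, one_mul, hv20, hγ21, ← WithZero.exp_add]
    congr 1; ring
  -- shared inputs of the two halves
  have e2 : ((2 : 𝒪[w.1.adicCompletion L]) : w.1.adicCompletion L) = 2 := map_ofNat (𝒪[w.1.adicCompletion L]).subtype 2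
  have h20 : (2 : w.1.adicCompletion L) ≠ 0 := by
    intro h; rw [h, map_zero] at hv2; exact zero_ne_one hv2
  have htr : ∃ b : 𝒪[w.1.adicCompletion L], (b : w.1.adicCompletion L) + σw b = 1 := by
    refine ⟨↑(h2.unit⁻¹), ?_⟩
    have hb : (2 : w.1.adicCompletion L) * ((↑(h2.unit⁻¹) : 𝒪[w.1.adicCompletion L]) : w.1.adicCompletion L) = 1 := by
      have h' := congrArg (fun z : 𝒪[w.1.adicCompletion L] => (z : w.1.adicCompletion L)) h2.mul_val_inv
      simp only [MulMemClass.coe_mul, OneMemClass.coe_one, e2] at h'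
      exact h'
    have hσb : σw (((↑(h2.unit⁻¹) : 𝒪[w.1.adicCompletion L]) : w.1.adicCompletion L)) =
        ((↑(h2.unit⁻¹) : 𝒪[w.1.adicCompletion L]) : w.1.adicCompletion L) := by
      have h' := congrArg σw hb
      rw [map_mul, map_ofNat, map_one] at h'
      exact mul_left_cancel₀ h20 (h'.trans hb.symm)
    rw [hσb]; linear_combination hb
  have hnorm : ∀ u : 𝒪[w.1.adicCompletion L], IsUnit u → σw u = u → ∃ s : 𝒪[w.1.adicCompletion L], (s : w.1.adicCompletion L) * σw s = u :=
    fun u hu hσu => LocalFields.UnramifiedQuadraticNorm.exists_mul_map_eq_of_isUnit_integer σw hσσ hσO hmove u hu hσu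
  have hγu : ∀ i, ∃ y ∈ 𝒪[w.1.adicCompletion L], y * γ i = 1 :=
    fun i => ⟨σw (γ i), hσO ⟨γ i, hγO i⟩, by rw [hσγ i, inv_mul_cancel₀ (hγ0 i)]⟩
  obtain ⟨r, hr⟩ := exists_poly_eval_mul_eq_one 𝒪[w.1.adicCompletion L] hγO hγu
  split_ifs with hpar
  · -- THE PARITY LITERAL (both even): every criterion scalar is an even power of `ϖ`
    obtain ⟨hp1, hp2⟩ := hpar
    have hev : ∀ i, ∃ k : ℤ, ValuativeRel.valuation (w.1.adicCompletion L) (![-2, 1, 2] i * ∏ j ∈ univ.erase i, (γ i - γ j)) =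
        ValuativeRel.valuation (w.1.adicCompletion L) (ϖ ^ (2 * k)) := by
      intro i
      match i with
      | 0 =>
        obtain ⟨b, hb⟩ := Nat.even_iff.2 hp1
        refine ⟨(b : ℤ), valuation_eq_valuation_zpow_of_valued_eq L w hϖv ?_⟩
        rw [hE0]; congr 1; omega
      | 1 =>
        obtain ⟨b, hb⟩ := Nat.even_iff.2 hp2
        refine ⟨(b : ℤ), valuation_eq_valuation_zpow_of_valued_eq L w hϖv ?_⟩
        rw [hE1]; congr 1; omega
      | 2 =>
        have hp3 : (P + Q₂) % 2 = 0 := by omega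
        obtain ⟨b, hb⟩ := Nat.even_iff.2 hp3
        refine ⟨(b : ℤ), valuation_eq_valuation_zpow_of_valued_eq L w hϖv ?_⟩
        rw [hE2]; congr 1; omega
    have hcount := ncard_setOf_selfDual_cyclic_eq_relIndex_of_even σw hσσ hσO hmove hσv h2 δ hδ hσδ hϖ0 hσϖ hH'w.unit hH'i hJh Qw
      ![-2, 1, 2] hGw hσd hγO hinj hσγ hγ1 hev
    refine (congrArg (fun m : ℕ => (m : ℚ)) hcount).trans ?_
    -- the value `[C : R^×] = (q+1)² q^{S−2}` (★ Σ2-CM `relIndex_units_adjoin_comap_norm_eq_place`)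
    obtain ⟨ιO, hιO⟩ := exists_integer_ringHom_toPlace v w
    have hϖE := isUniformizingElement_of_valued_eq L w.1 hϖv
    obtain ⟨γO, hγOdef⟩ : ∃ g : Fin 3 → 𝒪[w.1.adicCompletion L], g = fun i => ⟨γ i, hγO i⟩ := ⟨_, rfl⟩
    have hγOγ : (fun i => (γO i : w.1.adicCompletion L)) = γ := by rw [hγOdef]
    have hσγA : ∀ x ∈ Algebra.adjoin 𝒪[w.1.adicCompletion L] ({fun i => (γO i : w.1.adicCompletion L)} : Set (Fin 3 → w.1.adicCompletion L)),
        (fun i => σw (x i)) ∈ Algebra.adjoin 𝒪[w.1.adicCompletion L] ({fun i => (γO i : w.1.adicCompletion L)} : Set (Fin 3 → w.1.adicCompletion L)) := by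
      rw [hγOγ]
      exact fun x hx => map_mem_adjoin_of_map_eq_inv σw hσO hσγ hr hx
    obtain ⟨N, hNdef⟩ : ∃ N : Fin 3 → Fin 3 → ℕ, N = fun i j => (![![0, Q₁, P], ![0, 0, Q₂], ![0, 0, 0]] : Fin 3 → Fin 3 → ℕ) i j := ⟨_, rfl⟩
    have hQ₁1 : 1 ≤ Q₁ := one_le_of_valued_sub_eq_exp L w hd₁ hd₂ hQ₁
    have hP1 : 1 ≤ P := one_le_of_valued_sub_eq_exp L w hd₁ hd₃ hP
    have hQ₂1 : 1 ≤ Q₂ := one_le_of_valued_sub_eq_exp L w hd₃ hd₂ hQ₂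
    have hN01 : N 0 1 = Q₁ := by rw [hNdef]; rfl
    have hN02 : N 0 2 = P := by rw [hNdef]; rfl
    have hN12 : N 1 2 = Q₂ := by rw [hNdef]; rfl
    have hNpos : ∀ i j : Fin 3, i < j → 0 < N i j := by
      intro i j hij
      match i, j with
      | 0, 1 => rw [hN01]; omega
      | 0, 2 => rw [hN02]; omega
      | 1, 2 => rw [hN12]; omega
      | 0, 0 => exact absurd hij (by decide)
      | 1, 0 => exact absurd hij (by decide)
      | 1, 1 => exact absurd hij (by decide)
      | 2, 0 => exact absurd hij (by decide)
      | 2, 1 => exact absurd hij (by decide)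
      | 2, 2 => exact absurd hij (by decide)
    have hN : ∀ i j : Fin 3, i < j →
        ValuativeRel.valuation (w.1.adicCompletion L) ((γO j : w.1.adicCompletion L) - γO i) = ValuativeRel.valuation (w.1.adicCompletion L) ϖ ^ N i j := by
      intro i j hij
      subst hγOdef
      match i, j with
      | 0, 1 => rw [hN01]; exact valuation_eq_valuation_pow_of_valued_eq L w hϖv hv10
      | 0, 2 => rw [hN02]; exact valuation_eq_valuation_pow_of_valued_eq L w hϖv hv20
      | 1, 2 => rw [hN12]; exact valuation_eq_valuation_pow_of_valued_eq L w hϖv hγ21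
      | 0, 0 => exact absurd hij (by decide)
      | 1, 0 => exact absurd hij (by decide)
      | 1, 1 => exact absurd hij (by decide)
      | 2, 0 => exact absurd hij (by decide)
      | 2, 1 => exact absurd hij (by decide)
      | 2, 2 => exact absurd hij (by decide)
    have hval := relIndex_units_adjoin_comap_norm_eq_place (IsCMField.complexConj L) v hc1 hv w hw hv2 ιO hιO hϖE (by norm_num : 0 < 3) γO N hNpos hN hσγA
    have hI0 : Finset.Ioi (0 : Fin 3) = {1, 2} := by decide
    have hI1 : Finset.Ioi (1 : Fin 3) = {2} := by decide
    have hI2 : Finset.Ioi (2 : Fin 3) = ∅ := by decide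
    have hsum : (∑ i : Fin 3, ∑ j ∈ Finset.Ioi i, N i j) = Q₁ + P + Q₂ := by
      rw [Fin.sum_univ_three, hI0, hI1, hI2, Finset.sum_pair (by decide), Finset.sum_singleton, Finset.sum_empty, hN01, hN02, hN12, add_zero]
    rw [hsum, show (3 : ℕ) - 1 = 2 from rfl, hγOγ] at hval
    rw [show Q₁ + Q₂ + P - 2 = Q₁ + P + Q₂ - 2 by omega]
    exact_mod_cast hval
  · -- NOT THE PARITY LITERAL: one criterion scalar is an odd power of `ϖ`
    have hϖodd := fun b k => valuation_mul_map_mul_valuation_zpow_odd_ne_one L w hw hϖv b k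
    by_cases hA : (Q₁ + P) % 2 = 0
    · have hB : (Q₁ + Q₂) % 2 = 1 := by
        by_contra hB'
        exact hpar ⟨hA, by omega⟩
      obtain ⟨b, hb⟩ := Nat.odd_iff.2 hB
      have hi : ValuativeRel.valuation (w.1.adicCompletion L) (![-2, 1, 2] 1 * ∏ j ∈ univ.erase (1 : Fin 3), (γ 1 - γ j)) =
          ValuativeRel.valuation (w.1.adicCompletion L) (ϖ ^ (2 * (b : ℤ) + 1)) := by
        refine valuation_eq_valuation_zpow_of_valued_eq L w hϖv ?_
        rw [hE1]; congr 1; omega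
      have h0 := ncard_setOf_selfDual_cyclic_eq_zero_of_odd σw hσσ hσO htr hnorm hσv hϖodd hH'w.unit hH'i hJh Qw ![-2, 1, 2] hGw
        hγO hinj hσγ hr hi
      rw [h0, Nat.cast_zero]
    · have hA' : (Q₁ + P) % 2 = 1 := by omega
      obtain ⟨b, hb⟩ := Nat.odd_iff.2 hA'
      have hi : ValuativeRel.valuation (w.1.adicCompletion L) (![-2, 1, 2] 0 * ∏ j ∈ univ.erase (0 : Fin 3), (γ 0 - γ j)) =
          ValuativeRel.valuation (w.1.adicCompletion L) (ϖ ^ (2 * (b : ℤ) + 1)) := by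
        refine valuation_eq_valuation_zpow_of_valued_eq L w hϖv ?_
        rw [hE0]; congr 1; omega
      have h0 := ncard_setOf_selfDual_cyclic_eq_zero_of_odd σw hσσ hσO htr hnorm hσv hϖodd hH'w.unit hH'i hJh Qw ![-2, 1, 2] hGw
        hγO hinj hσγ hr hi
      rw [h0, Nat.cast_zero]


end ThetaZero

end Literature.NumberTheory.Rogawski1990

end
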